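import Summits.QuantumFields.YangMills.Theorems.BalabanUVNodesN15KingModelPotentialComplexRate
import Literature.MathematicalPhysics.QuantumFieldTheory.Balaban1983to89.B13RealSliceEntryLetters

/-!
# N15 (NE2) King-model rung, PART 32 — THE LETTERS AT COMPLEX COUPLING FROM THE REAL SLICE, BY NAME:
# locality of the dressed levels and covariances and the η-rate WITH decay at complex coupling, with ONE exponent UNIFORM on the disc

Eleventh generation (g11) of the seat `pub-ymgap-dag-n15-d`, part 32 (on 31 `…PotentialComplexRate` and the tree's Literature module
`Balaban1983to89.B13RealSliceEntryLetters`, which packages `Literature.Analysis.Complex.TwoConstantsDisc.norm_le_two_constants_disc_of_norm_le`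
— the two-constants theorem on the disc with the exponent `λ(r) = (2∕π)·arctan(2r∕(1−r²))` UNIFORM on `‖z‖ ≤ r` — as the slice transfer
`norm_le_of_realSlice` ∕ `decay_of_realSlice` along the chart `realStructureComplex`).  [B9] Theorem 3.4 says of the complexified operators: «the extended
operators satisfy all the inequalities of Theorems 3.1–3.3» (with slightly worse constants).  In King's A = 0 model the REAL-slice inequalities are
theorems of this lineage — the (4.34)-type LOCALITY of the dressed levels (9c `uniformKernelDecay_kingTowerPot`) and of the dressed covariances
(9c `kingCovPot_decay`), and the (4.38) two-spacing η-RATE with decay (10e `covarianceTowerRate_fullPert`) — while 28b supplies holomorphy and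
rate-free bounds on the complex coupling disc.  The two-constants theorem transports every real-slice smallness to the disc; this file only CITES it:

* §1 (any unit torus `Π ℤ∕(LM_μ)`, `L ≥ 2`, `a, m² > 0`, `k ≥ 1`): `differentiableOn_kingLevelPotC_ball` ∕ `differentiableOn_kingCovPotC_ball` (28b on the ball
  `‖z‖ < R₁ := min(r_K∕w₀, 1)`), ★ `kingLevelPotC_apply_decay` — **(4.34)(ii) AT COMPLEX COUPLING**: `‖Δ^{(k)}_{z·v}(b,b′)‖ ≤ M_Δ·e^{−(1−λ(r))·2κ′·|b−b′|}` on
  `‖z‖ < (r∕(1+r))·R₁`, and ★★ `kingCovPotC_apply_decay` — **(4.34)(i) AT COMPLEX COUPLING**: `‖C^{(k)}_z(x,y)‖ ≤ (4∕γ₀)·e^{−(1−λ(r))·κ′·|x−y|}` there; both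
  uniform in `k`, the volume and the potential (window `sup|v| ≤ w₀ ≤ w̄`, 9c's smallness `c_E(w₀) ≤ c̄`), every `0 < r < 1`;
* §2 (King-admissible tori `Π ℤ∕(2L^{e+1})`, odd `L ≥ 3`): ★★★ `kingCov_twoSpacing_complexRate_uniform` — **(4.38) AT COMPLEX COUPLING WITH ONE EXPONENT AND
  WITH DECAY**: `‖C^{(k+1)}_{z·v}(x,y) − C^{(k)}_{z·v}(x,y)‖ ≤ (C·θ^k)^{1−λ(r)}·M^{λ(r)}·e^{−(1−λ(r))(κ∕2)|x−y|}` for EVERY `z` of the disc `‖z‖ < (r∕(1+r))·R₁`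
  (`θ = L^{−1∕4}`, `M = max(C, 4∕γ₀)`); `kingCov_twoSpacing_complexRate_geometric` — the same written as a GEOMETRIC rate `(θ^{1−λ(r)})^k`; and
  `kingCov_twoSpacing_complexRate_uniform_lin` — the exponent made elementary, `λ(r) ≤ (4∕π)·r` (`lam_le`).
  Part 31 gave the interpolated exponent `σ` only at the points `x₀ ± iρ·tan(πσ∕6)` and no decay off the axis; here the exponent is uniform on the
  disc and the decay in `|x − y|` survives — g10's doors (t8) and (t9), by citation instead of a new Combes–Thomas estimate.

References (method): two-constants theorem [Ransford1995, Thm. 4.3.7] via the tree's `TwoConstantsDisc` ∕ `B13RealSliceEntryLetters` (cited BY NAME, dag-lead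
DEDUP-323 (6)); template [B9] Thm 3.4 p.400, (3.108) p.416; King (4.34), (4.38) p.674.

HONEST SCOPE.  King's A = 0 SCALAR model; REAL potential towers × ONE complex coupling `z` (a complex mass insertion — NOT a gauge field, NOT
Bałaban's `U′U = e^{iηA}U`); the losses are exactly those of the two-constants theorem (radius factor `r∕(1+r)`, exponent factor `1 − λ(r)`);
nothing is claimed for Bałaban's `C^{(k)}(Λ;U)`; NOT a node discharge; count-neutral.  No `sorry`, standard axioms, default heartbeats.
-/

noncomputable section

open scoped BigOperators Matrix
open Filter Topology Metric Finset Complex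

namespace Summit.QuantumFields.YangMills.BalabanUVNodes.N15.KingModel

open Literature.MathematicalPhysics.QuantumFieldTheory.Balaban1983to89 hiding blockOf
open Literature.MathematicalPhysics.QuantumFieldTheory.Balaban1983to89.B5Prop11Plancherel (Tor fine)
open Literature.MathematicalPhysics.QuantumFieldTheory.Balaban1983to89.B13RealSliceEntryLetters (lam lam_nonneg lam_lt_one lam_le
  decay_of_realSlice norm_le_of_realSlice realStructureComplex)
open Literature.MathematicalPhysics.QuantumFieldTheory.King1986 (aK aK_pos aK_le)
open Literature.MathematicalPhysics.QuantumFieldTheory.King1986.Torus (gam0L gam0L_pos tdistT tdistT_isPseudoDist kapCT kapCT_pos_le)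
open Summit.QuantumFields.BalabanUV.T4Continuum.NE2KingTransplant (IsPseudoMetric)
open Summit.QuantumFields.YangMills.BalabanUVNodes.N15KingModelRung.Curved (underPtN)

variable {d : ℕ}

/-! ## §1 Locality of the dressed levels and covariances at complex coupling (any unit torus) -/

section Locality

variable {a m2 : ℝ} {L : ℕ} [NeZero L] {M : Fin (d + 1) → ℕ} [∀ μ, NeZero (M μ)]

omit [NeZero L] in
/-- On the ball `‖z‖ < min(r_K∕w₀, 1)` the product `‖z‖·w₀` stays in 28b's window `r_K`. [folklore] -/
theorem norm_mul_le_cplxWindow_of_mem_ball {w₀ : ℝ} (hw₀ : 0 < w₀) {z : ℂ}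
    (hz : z ∈ ball (0 : ℂ) (min (cplxWindow d a m2 L / w₀) 1)) : ‖z‖ * w₀ ≤ cplxWindow d a m2 L := by
  rw [mem_ball_zero_iff] at hz
  have hz' : ‖z‖ < cplxWindow d a m2 L / w₀ := lt_of_lt_of_le hz (min_le_left _ _)
  have : ‖z‖ * w₀ < cplxWindow d a m2 L / w₀ * w₀ := mul_lt_mul_of_pos_right hz' hw₀
  rw [div_mul_cancel₀ _ hw₀.ne'] at this
  exact this.le

/-- **Holomorphy of the dressed LEVEL entries on the ball** `‖z‖ < min(r_K∕w₀, 1)` (28b `differentiableAt_effLaplacianPotC_apply`; `r_K ≤ m²∕2 < m²`).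
[cite: Balaban1985BackgroundPropagators, Thm 3.4 p.400 (template); King1986, (2.14) p.653] -/
theorem differentiableOn_kingLevelPotC_ball (ha : 0 < a) (hm : 0 < m2) (hL : 2 ≤ L) {k : ℕ} (hk : 1 ≤ k)
    {w : Tor (fine (L ^ k) (fine L M)) → ℝ} {w₀ : ℝ} (hw₀ : 0 < w₀) (hw : ∀ x, |w x| ≤ w₀) (b b' : Tor (fine L M)) :
    DifferentiableOn ℂ (fun z => kingLevelPotC d a m2 L M k z w b b') (ball 0 (min (cplxWindow d a m2 L / w₀) 1)) := by
  intro z hz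
  have hLr : (1 : ℝ) < L := by exact_mod_cast (by omega : 1 < L)
  have haK := aK_pos ha hLr hk
  have hzw := norm_mul_le_cplxWindow_of_mem_ball (d := d) (a := a) (m2 := m2) (L := L) hw₀ hz
  have hzm : ‖z‖ * w₀ < m2 := lt_of_le_of_lt (hzw.trans (min_le_left _ _)) (by linarith)
  exact (differentiableAt_effLaplacianPotC_apply (N := L ^ k) (U := fine L M) (a := aK a L k) (c := ((L ^ k : ℕ) : ℝ) ^ 2) (m2 := m2)
    haK.le (by positivity) hw hzm b b').differentiableWithinAt

/-- **Holomorphy of the dressed COVARIANCE entries on the ball** `‖z‖ < min(r_K∕w₀, 1)` (28b `differentiableAt_kingCovPotC_apply`).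
[cite: Balaban1985BackgroundPropagators, Thm 3.4 p.400 (template); King1986, (4.32) p.674] -/
theorem differentiableOn_kingCovPotC_ball (ha : 0 < a) (hm : 0 < m2) (hL : 2 ≤ L) {k : ℕ} (hk : 1 ≤ k)
    {w : Tor (fine (L ^ k) (fine L M)) → ℝ} {w₀ : ℝ} (hw₀ : 0 < w₀) (hw : ∀ x, |w x| ≤ w₀) (x y : Tor (fine L M)) :
    DifferentiableOn ℂ (fun z => kingCovPotC d a m2 L M k z w x y) (ball 0 (min (cplxWindow d a m2 L / w₀) 1)) := fun _ hz =>
  DifferentiableAt.differentiableWithinAt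
    (differentiableAt_kingCovPotC_apply (M := M) ha hm hL hk hw₀.le hw (norm_mul_le_cplxWindow_of_mem_ball (d := d) (a := a) (m2 := m2) (L := L) hw₀ hz) x y)

/-- A point of `realStructureComplex.Ereal` of norm `< R ≤ 1` is a real coupling `t` with `|t| < 1`. [folklore] -/
theorem exists_real_of_mem_Ereal {u : ℂ} (hu : u ∈ realStructureComplex.Ereal) {R : ℝ} (hR : R ≤ 1) (huR : ‖u‖ < R) :
    ∃ t : ℝ, (t : ℂ) = u ∧ |t| < 1 := by
  obtain ⟨t, rfl⟩ := hu
  refine ⟨t, rfl, ?_⟩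
  rw [Complex.norm_real, Real.norm_eq_abs] at huR
  exact lt_of_lt_of_le huR hR

omit [NeZero L] [∀ μ, NeZero (M μ)] in
/-- Scaling a potential tower by a real `t` with `|t| ≤ 1` keeps the two-sided size bound. [folklore] -/
theorem abs_smul_tower_le_of_le_one {v : ∀ N : ℕ, Tor (fine N (fine L M)) → ℝ} {w₀ : ℝ} (hv : ∀ N x, |v N x| ≤ w₀) {t : ℝ} (ht : |t| ≤ 1)
    (N : ℕ) (x : Tor (fine N (fine L M))) : |(t • v) N x| ≤ w₀ := by
  show |t * v N x| ≤ w₀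
  rw [abs_mul]
  have h0 : 0 ≤ w₀ := (abs_nonneg _).trans (hv N x)
  calc |t| * |v N x| ≤ 1 * w₀ := mul_le_mul ht (hv N x) (abs_nonneg _) zero_le_one
    _ = w₀ := one_mul _

/-- ★ **(4.34)(ii) AT COMPLEX COUPLING — THE DRESSED LEVELS ARE EXPONENTIALLY LOCAL OFF THE REAL AXIS.**  For `L ≥ 2`, `a, m² > 0`, `k ≥ 1`, a potential
tower with `sup|v_N| ≤ w₀`, `0 < w₀ ≤ w̄ = wbarK`, every `0 < r < 1` and every complex coupling with `‖z‖ < (r∕(1+r))·min(r_K∕w₀, 1)`: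
`‖Δ^{(k)}_{z·v}(b,b′)‖ ≤ M_Δ·e^{−(1−λ(r))·2κ′·|b−b′|_T}`, `M_Δ = max(a + a²·ctCK, a + 2a²∕m²)`, `κ′ = kapCT` — the real-slice decay (9c
`uniformKernelDecay_kingTowerPot`) and the disc bound (28d `norm_kingLevelPotC_apply_le`) interpolated by the two-constants theorem
(`B13RealSliceEntryLetters.decay_of_realSlice`, BY NAME).
[cite: King1986, (4.34) p.674 (A = 0 template); Balaban1985BackgroundPropagators, Thm 3.4 p.400; Ransford1995, Thm. 4.3.7] -/
theorem kingLevelPotC_apply_decay (ha : 0 < a) (hm : 0 < m2) (hL : 2 ≤ L) {k : ℕ} (hk : 1 ≤ k)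
    {v : ∀ N : ℕ, Tor (fine N (fine L M)) → ℝ} {w₀ : ℝ} (hw₀ : 0 < w₀) (hwb : w₀ ≤ wbarK (d + 1) a L) (hv : ∀ N x, |v N x| ≤ w₀)
    {r : ℝ} (hr0 : 0 < r) (hr1 : r < 1) {z : ℂ} (hz : ‖z‖ < r / (1 + r) * min (cplxWindow d a m2 L / w₀) 1) (b b' : Tor (fine L M)) :
    ‖kingLevelPotC d a m2 L M k z (v (L ^ k)) b b'‖
      ≤ max (a + a ^ 2 * ctCK (d + 1) a L) (a + 2 * a ^ 2 / m2)
          * Real.exp (-((1 - lam r) * (2 * kapCT (d + 1) a L) * tdistT (fine L M) b b')) := by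
  set R₁ : ℝ := min (cplxWindow d a m2 L / w₀) 1 with hR₁
  set B : ℝ := a + a ^ 2 * ctCK (d + 1) a L with hB
  set Mb : ℝ := max B (a + 2 * a ^ 2 / m2) with hMb
  have hCK := (dressedConsts_nonneg (d := d) ha hL).1
  have hB0 : 0 ≤ B := by positivity
  have hκ := (kapCT_pos_le (d := d + 1) ha hL).1
  -- the family of level entries as a function of the complex coupling
  set K : ℂ → Matrix (Tor (fine L M)) (Tor (fine L M)) ℂ := fun u => kingLevelPotC d a m2 L M k u (v (L ^ k)) with hK
  have hKd : ∀ i j, DifferentiableOn ℂ (fun u => K u i j) (ball (0 : ℂ) R₁) := fun i j =>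
    differentiableOn_kingLevelPotC_ball (d := d) ha hm hL hk hw₀ (hv _) i j
  have hKM : ∀ u ∈ ball (0 : ℂ) R₁, ∀ i j, ‖K u i j‖ ≤ Mb := fun u hu i j =>
    (norm_kingLevelPotC_apply_le (M := M) ha hm hL hk (hv _) (norm_mul_le_cplxWindow_of_mem_ball (d := d) (a := a) (m2 := m2) (L := L) hw₀ hu) i j).trans
      (le_max_right _ _)
  have hKB : ∀ u ∈ realStructureComplex.Ereal, ‖u‖ < R₁ → ∀ i j,
      ‖K u i j‖ ≤ B * Real.exp (-((2 * kapCT (d + 1) a L) * tdistT (fine L M) i j)) := by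
    intro u hu huR i j
    obtain ⟨t, rfl, ht⟩ := exists_real_of_mem_Ereal hu (min_le_right _ _) huR
    have hlo : ∀ N x, -w₀ ≤ (t • v) N x := fun N x => (abs_le.mp (abs_smul_tower_le_of_le_one hv ht.le N x)).1
    have hdec := uniformKernelDecay_kingTowerPot (M := M) (m2 := m2) ha hm hL hwb hlo k i j
    show ‖kingLevelPotC d a m2 L M k (t : ℂ) (v (L ^ k)) i j‖ ≤ _
    rw [kingLevelPotC_real_eq_kingTowerPot v hk t i j, Complex.norm_real, Real.norm_eq_abs]
    simpa only [mul_assoc] using hdec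
  have hdist : ∀ i j : Tor (fine L M), 0 ≤ tdistT (fine L M) i j := (tdistT_isPseudoDist (fine L M)).nonneg
  have key := decay_of_realSlice realStructureComplex hKd hKM hKB hB0 (le_max_left _ _) (by positivity) hdist hr0 hr1 z
    (by rwa [mem_ball_zero_iff]) b b'
  refine key.trans (mul_le_mul_of_nonneg_right ?_ (Real.exp_pos _).le)
  -- `B^{1−λ}·Mb^{λ} ≤ Mb` since `B ≤ Mb`
  have hlam0 := lam_nonneg hr0.le hr1
  have hlam1 := (lam_lt_one r).le
  have hMb0 : 0 ≤ Mb := hB0.trans (le_max_left _ _)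
  have hsum : (1 - lam r) + lam r = 1 := by ring
  calc B ^ (1 - lam r) * Mb ^ lam r ≤ Mb ^ (1 - lam r) * Mb ^ lam r :=
        mul_le_mul_of_nonneg_right (Real.rpow_le_rpow hB0 (le_max_left _ _) (by linarith)) (Real.rpow_nonneg hMb0 _)
    _ = Mb := by rw [← Real.rpow_add' hMb0 (by rw [hsum]; exact one_ne_zero), hsum, Real.rpow_one]

/-- ★★ **(4.34)(i) AT COMPLEX COUPLING — THE DRESSED COVARIANCES ARE EXPONENTIALLY LOCAL OFF THE REAL AXIS.**  For `L ≥ 2`, `a, m² > 0`, `k ≥ 1`, a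
potential tower with `sup|v_N| ≤ w₀`, `0 < w₀ ≤ w̄`, 9c's smallness `a²·ctCK²·kwSum·w₀ ≤ c̄ = kingCbar`, every `0 < r < 1` and every complex coupling
with `‖z‖ < (r∕(1+r))·min(r_K∕w₀, 1)`:  `‖C^{(k)}_z(x,y)‖ ≤ (4∕γ₀)·e^{−(1−λ(r))·κ′·|x−y|_T}` (`κ′ = kapCT`), uniformly in `k`, the volume and the
potential — the real-slice decay (9c `kingCovPot_decay`) and the disc bound `2∕γ₀ ≤ 4∕γ₀` (28b `kingCovPotC_apply_norm_le`) interpolated by the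
two-constants theorem (`decay_of_realSlice`, BY NAME).
[cite: King1986, (4.34) p.674 (A = 0 template); Balaban1985BackgroundPropagators, Thm 3.4 p.400, (3.108) p.416; Ransford1995, Thm. 4.3.7] -/
theorem kingCovPotC_apply_decay (ha : 0 < a) (hm : 0 < m2) (hL : 2 ≤ L) {k : ℕ} (hk : 1 ≤ k)
    {v : ∀ N : ℕ, Tor (fine N (fine L M)) → ℝ} {w₀ : ℝ} (hw₀ : 0 < w₀) (hwb : w₀ ≤ wbarK (d + 1) a L) (hv : ∀ N x, |v N x| ≤ w₀)
    (hsmall : a ^ 2 * ctCK (d + 1) a L ^ 2 * kwSum (d + 1) a L * w₀ ≤ kingCbar (d + 1) a L)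
    {r : ℝ} (hr0 : 0 < r) (hr1 : r < 1) {z : ℂ} (hz : ‖z‖ < r / (1 + r) * min (cplxWindow d a m2 L / w₀) 1) (x y : Tor (fine L M)) :
    ‖kingCovPotC d a m2 L M k z (v (L ^ k)) x y‖
      ≤ 4 / gam0L (d + 1) a L * Real.exp (-((1 - lam r) * kapCT (d + 1) a L * tdistT (fine L M) x y)) := by
  set R₁ : ℝ := min (cplxWindow d a m2 L / w₀) 1 with hR₁
  have hγ := gam0L_pos (d := d + 1) ha hL
  have hκ := (kapCT_pos_le (d := d + 1) ha hL).1
  set B : ℝ := 4 / gam0L (d + 1) a L with hB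
  have hB0 : 0 ≤ B := by positivity
  set K : ℂ → Matrix (Tor (fine L M)) (Tor (fine L M)) ℂ := fun u => kingCovPotC d a m2 L M k u (v (L ^ k)) with hK
  have hKd : ∀ i j, DifferentiableOn ℂ (fun u => K u i j) (ball (0 : ℂ) R₁) := fun i j =>
    differentiableOn_kingCovPotC_ball (d := d) ha hm hL hk hw₀ (hv _) i j
  have hKM : ∀ u ∈ ball (0 : ℂ) R₁, ∀ i j, ‖K u i j‖ ≤ B := by
    intro u hu i j
    have h := kingCovPotC_apply_norm_le (M := M) ha hm hL hk hw₀.le (hv _) (norm_mul_le_cplxWindow_of_mem_ball (d := d) (a := a) (m2 := m2) (L := L) hw₀ hu) i j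
    refine h.trans ?_
    rw [hB, div_le_div_iff_of_pos_right hγ]
    norm_num
  have hKB : ∀ u ∈ realStructureComplex.Ereal, ‖u‖ < R₁ → ∀ i j,
      ‖K u i j‖ ≤ B * Real.exp (-(kapCT (d + 1) a L * tdistT (fine L M) i j)) := by
    intro u hu huR i j
    obtain ⟨t, rfl, ht⟩ := exists_real_of_mem_Ereal hu (min_le_right _ _) huR
    have hvt : ∀ N x, |(t • v) N x| ≤ w₀ := abs_smul_tower_le_of_le_one hv ht.le
    have hdec := kingCovPot_decay (M := M) ha hm hL hw₀.le hwb hvt hsmall k i j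
    show ‖kingCovPotC d a m2 L M k (t : ℂ) (v (L ^ k)) i j‖ ≤ _
    rw [kingCovPotC_real_eq_kingCovE v hk t i j, Complex.norm_real, Real.norm_eq_abs, kingCovE_fullPert]
    exact hdec
  have hdist : ∀ i j : Tor (fine L M), 0 ≤ tdistT (fine L M) i j := (tdistT_isPseudoDist (fine L M)).nonneg
  have key := decay_of_realSlice realStructureComplex hKd hKM hKB hB0 le_rfl hκ.le hdist hr0 hr1 z (by rwa [mem_ball_zero_iff]) x y
  refine key.trans (le_of_eq ?_)
  have hsum : (1 - lam r) + lam r = 1 := by ring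
  rw [← Real.rpow_add' hB0 (by rw [hsum]; exact one_ne_zero), hsum, Real.rpow_one]

end Locality

/-! ## §2 The η-rate at complex coupling with ONE exponent uniform on the disc, and with decay (King-admissible tori) -/

section Rate

variable (L : ℕ) [NeZero L]

/-- ★★★ **(4.38) AT COMPLEX COUPLING — NE2's η-RATE WITH DECAY, ONE EXPONENT UNIFORM ON THE DISC.**  For odd `L ≥ 3`, `a, m² > 0` there are
`κ, w₁, C > 0` such that for every volume exponent `e`, every potential tower `v` with `sup|v_N| ≤ w₀ ≤ w₁`, `w₀ > 0`, coherence defect `≤ ν₀s^k`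
(`0 ≤ ν₀ ≤ w₁`, `0 ≤ s ≤ L^{−1∕2}`), all unit sites `x, y`, every `k ≥ 1`, every `0 < r < 1` and EVERY complex coupling `z` with
`‖z‖ < (r∕(1+r))·min(r_K∕w₀, 1)`:
`‖C^{(k+1)}_{z·v}(x,y) − C^{(k)}_{z·v}(x,y)‖ ≤ (C·θ^k)^{1−λ(r)}·M^{λ(r)}·e^{−(1−λ(r))·(κ∕2)·|x−y|_T}`, `θ = L^{−1∕4}`, `M = max(C, 4∕γ₀)`,
`λ(r) = (2∕π)·arctan(2r∕(1−r²)) < 1` — 10e's real rate WITH decay on the diameter and 28b's bound on the disc, interpolated by the two-constants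
theorem with the exponent uniform on `‖·‖ ≤ r` (`B13RealSliceEntryLetters.decay_of_realSlice` over `TwoConstantsDisc.norm_le_two_constants_disc_of_norm_le`,
BY NAME).  [cite: King1986, Lemma 4.5 (4.38) p.674 (A = 0 template); Balaban1985BackgroundPropagators, Thm 3.4 p.400; Ransford1995, Thm. 4.3.7] -/
theorem kingCov_twoSpacing_complexRate_uniform (hLodd : Odd L) (hL : 2 ≤ L) {a m2 : ℝ} (ha : 0 < a) (hm : 0 < m2) :
    ∃ κ w₁ C : ℝ, 0 < κ ∧ 0 < w₁ ∧ 0 < C ∧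
      ∀ (e : ℕ) (v : ∀ N : ℕ, Tor (fine N (kingU d L e)) → ℝ) (w₀ ν₀ s : ℝ),
      0 ≤ ν₀ → ν₀ ≤ w₁ → 0 ≤ s → s ≤ (L : ℝ) ^ (-(1 / 2 : ℝ)) →
      0 < w₀ → (∀ (N : ℕ) (x : Tor (fine N (kingU d L e))), |v N x| ≤ w₀) → w₀ ≤ w₁ →
      (∀ (k : ℕ), 1 ≤ k → ∀ x' : Tor (fine (L ^ 1 * L ^ k) (kingU d L e)),
          |v (L ^ 1 * L ^ k) x' - v (L ^ k) (underPtN L k 1 (kingU d L e) x')| ≤ ν₀ * s ^ k) →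
      ∀ (x y : Tor (kingU d L e)) (k : ℕ), 1 ≤ k →
      ∀ (r : ℝ), 0 < r → r < 1 → ∀ z : ℂ, ‖z‖ < r / (1 + r) * min (cplxWindow d a m2 L / w₀) 1 →
        ‖kingCovPotC d a m2 L (kingM d L e) (k + 1) z (v (L ^ (k + 1))) x y - kingCovPotC d a m2 L (kingM d L e) k z (v (L ^ k)) x y‖
          ≤ (C * (((L : ℝ) ^ (-(1 / 4 : ℝ))) ^ k)) ^ (1 - lam r) * (max C (4 / gam0L (d + 1) a L)) ^ lam r
              * Real.exp (-((1 - lam r) * (κ / 2) * tdistT (kingU d L e) x y)) := by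
  obtain ⟨κ, w₁, C, hκ, hw₁, hC, H⟩ := covarianceTowerRate_fullPert (d := d) L hLodd hL ha hm
  refine ⟨κ, w₁, C, hκ, hw₁, hC, ?_⟩
  intro e v w₀ ν₀ s hν₀ hν₁ hs0 hs1 hw₀ hv hw₁' hcoh x y k hk r hr0 hr1 z hz
  have hγ := gam0L_pos (d := d + 1) ha hL
  set θ : ℝ := (L : ℝ) ^ (-(1 / 4 : ℝ)) with hθ
  set R₁ : ℝ := min (cplxWindow d a m2 L / w₀) 1 with hR₁
  have hθ0 : 0 ≤ θ := Real.rpow_nonneg (Nat.cast_nonneg _) _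
  have hθ1 : θ ≤ 1 := by
    have hL1 : (1 : ℝ) ≤ L := by exact_mod_cast (by omega : 1 ≤ L)
    exact Real.rpow_le_one_of_one_le_of_nonpos hL1 (by norm_num)
  have hk1 : 1 ≤ k + 1 := Nat.succ_le_succ (Nat.zero_le k)
  -- the two-spacing difference as a matrix-valued function of the complex coupling
  set K : ℂ → Matrix (Tor (kingU d L e)) (Tor (kingU d L e)) ℂ := fun u =>
    kingCovPotC d a m2 L (kingM d L e) (k + 1) u (v (L ^ (k + 1))) - kingCovPotC d a m2 L (kingM d L e) k u (v (L ^ k)) with hK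
  have hKd : ∀ i j, DifferentiableOn ℂ (fun u => K u i j) (ball (0 : ℂ) R₁) := fun i j =>
    (differentiableOn_kingCovPotC_ball (d := d) ha hm hL hk1 hw₀ (hv _) i j).sub
      (differentiableOn_kingCovPotC_ball (d := d) ha hm hL hk hw₀ (hv _) i j)
  have hKM : ∀ u ∈ ball (0 : ℂ) R₁, ∀ i j, ‖K u i j‖ ≤ max C (4 / gam0L (d + 1) a L) := by
    intro u hu i j
    have hzw := norm_mul_le_cplxWindow_of_mem_ball (d := d) (a := a) (m2 := m2) (L := L) hw₀ hu
    refine le_trans ?_ (le_max_right _ _)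
    calc ‖K u i j‖ ≤ ‖kingCovPotC d a m2 L (kingM d L e) (k + 1) u (v (L ^ (k + 1))) i j‖ + ‖kingCovPotC d a m2 L (kingM d L e) k u (v (L ^ k)) i j‖ := by
          simp only [hK, Matrix.sub_apply]; exact norm_sub_le _ _
      _ ≤ 2 / gam0L (d + 1) a L + 2 / gam0L (d + 1) a L :=
          add_le_add (kingCovPotC_apply_norm_le ha hm hL hk1 hw₀.le (hv _) hzw i j) (kingCovPotC_apply_norm_le ha hm hL hk hw₀.le (hv _) hzw i j)
      _ = 4 / gam0L (d + 1) a L := by ring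
  -- the real rate with decay on the diameter (10e on the tower `t·v`, `|t| < 1`)
  have hKB : ∀ u ∈ realStructureComplex.Ereal, ‖u‖ < R₁ → ∀ i j,
      ‖K u i j‖ ≤ C * θ ^ k * Real.exp (-(κ / 2 * tdistT (kingU d L e) i j)) := by
    intro u hu huR i j
    obtain ⟨t, rfl, ht1⟩ := exists_real_of_mem_Ereal hu (min_le_right _ _) huR
    have hvt : ∀ (N : ℕ) (x : Tor (fine N (kingU d L e))), |(t • v) N x| ≤ |t| * w₀ := by
      intro N x'
      show |t * v N x'| ≤ |t| * w₀
      rw [abs_mul]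
      exact mul_le_mul_of_nonneg_left (hv N x') (abs_nonneg t)
    have hcoht : ∀ (k : ℕ), 1 ≤ k → ∀ x' : Tor (fine (L ^ 1 * L ^ k) (kingU d L e)),
        |(t • v) (L ^ 1 * L ^ k) x' - (t • v) (L ^ k) (underPtN L k 1 (kingU d L e) x')| ≤ (|t| * ν₀) * s ^ k := by
      intro k hk x'
      show |t * v (L ^ 1 * L ^ k) x' - t * v (L ^ k) (underPtN L k 1 (kingU d L e) x')| ≤ (|t| * ν₀) * s ^ k
      rw [← mul_sub, abs_mul, mul_assoc]
      exact mul_le_mul_of_nonneg_left (hcoh k hk x') (abs_nonneg t)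
    have htw : |t| * w₀ ≤ w₁ := by nlinarith [abs_nonneg t]
    have htν : |t| * ν₀ ≤ w₁ := by nlinarith [abs_nonneg t]
    obtain ⟨hrate, -⟩ := H e (t • v) (|t| * w₀) (|t| * ν₀) s (by positivity) htν hs0 hs1 hvt htw hcoht
    have hr := hrate k i j
    show ‖kingCovPotC d a m2 L (kingM d L e) (k + 1) (t : ℂ) (v (L ^ (k + 1))) i j - kingCovPotC d a m2 L (kingM d L e) k (t : ℂ) (v (L ^ k)) i j‖ ≤ _
    rw [kingCovPotC_real_eq_kingCovE v hk1 t i j, kingCovPotC_real_eq_kingCovE v hk t i j, ← Complex.ofReal_sub, Complex.norm_real,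
      Real.norm_eq_abs, abs_sub_comm]
    exact hr
  have hdist : ∀ i j : Tor (kingU d L e), 0 ≤ tdistT (kingU d L e) i j := (tdistT_isPseudoDist (kingU d L e)).nonneg
  have hB0 : 0 ≤ C * θ ^ k := by positivity
  have hBM : C * θ ^ k ≤ max C (4 / gam0L (d + 1) a L) :=
    (mul_le_of_le_one_right hC.le (pow_le_one₀ hθ0 hθ1)).trans (le_max_left _ _)
  have key := decay_of_realSlice realStructureComplex hKd hKM hKB hB0 hBM (by positivity) hdist hr0 hr1 z (by rwa [mem_ball_zero_iff]) x y
  simpa only [hK, Matrix.sub_apply, mul_assoc] using key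

/-- **THE SAME AS A GEOMETRIC RATE**: with the data of `kingCov_twoSpacing_complexRate_uniform`, on the disc `‖z‖ < (r∕(1+r))·min(r_K∕w₀, 1)` the two-spacing
difference is `≤ C^{1−λ(r)}·M^{λ(r)}·(θ^{1−λ(r)})^k·e^{−(1−λ(r))(κ∕2)|x−y|_T}` — a `CovarianceTowerRate`-shaped letter at complex coupling with the
geometric ratio `θ^{1−λ(r)} < 1` and the decay rate `(1−λ(r))κ∕2`. [cite: King1986, Lemma 4.5 (4.38) p.674 (A = 0 template); Ransford1995, Thm. 4.3.7] -/
theorem kingCov_twoSpacing_complexRate_geometric (hLodd : Odd L) (hL : 2 ≤ L) {a m2 : ℝ} (ha : 0 < a) (hm : 0 < m2) :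
    ∃ κ w₁ C : ℝ, 0 < κ ∧ 0 < w₁ ∧ 0 < C ∧
      ∀ (e : ℕ) (v : ∀ N : ℕ, Tor (fine N (kingU d L e)) → ℝ) (w₀ ν₀ s : ℝ),
      0 ≤ ν₀ → ν₀ ≤ w₁ → 0 ≤ s → s ≤ (L : ℝ) ^ (-(1 / 2 : ℝ)) →
      0 < w₀ → (∀ (N : ℕ) (x : Tor (fine N (kingU d L e))), |v N x| ≤ w₀) → w₀ ≤ w₁ →
      (∀ (k : ℕ), 1 ≤ k → ∀ x' : Tor (fine (L ^ 1 * L ^ k) (kingU d L e)),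
          |v (L ^ 1 * L ^ k) x' - v (L ^ k) (underPtN L k 1 (kingU d L e) x')| ≤ ν₀ * s ^ k) →
      ∀ (x y : Tor (kingU d L e)) (k : ℕ), 1 ≤ k →
      ∀ (r : ℝ), 0 < r → r < 1 → ∀ z : ℂ, ‖z‖ < r / (1 + r) * min (cplxWindow d a m2 L / w₀) 1 →
        ‖kingCovPotC d a m2 L (kingM d L e) (k + 1) z (v (L ^ (k + 1))) x y - kingCovPotC d a m2 L (kingM d L e) k z (v (L ^ k)) x y‖
          ≤ C ^ (1 - lam r) * (max C (4 / gam0L (d + 1) a L)) ^ lam r * ((((L : ℝ) ^ (-(1 / 4 : ℝ))) ^ (1 - lam r)) ^ k)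
              * Real.exp (-((1 - lam r) * (κ / 2) * tdistT (kingU d L e) x y)) := by
  obtain ⟨κ, w₁, C, hκ, hw₁, hC, H⟩ := kingCov_twoSpacing_complexRate_uniform (d := d) L hLodd hL ha hm
  refine ⟨κ, w₁, C, hκ, hw₁, hC, ?_⟩
  intro e v w₀ ν₀ s hν₀ hν₁ hs0 hs1 hw₀ hv hw₁' hcoh x y k hk r hr0 hr1 z hz
  have h := H e v w₀ ν₀ s hν₀ hν₁ hs0 hs1 hw₀ hv hw₁' hcoh x y k hk r hr0 hr1 z hz
  refine h.trans (le_of_eq ?_)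
  set θ : ℝ := (L : ℝ) ^ (-(1 / 4 : ℝ)) with hθ
  have hθ0 : 0 ≤ θ := Real.rpow_nonneg (Nat.cast_nonneg _) _
  rw [Real.mul_rpow hC.le (pow_nonneg hθ0 k), ← Real.rpow_natCast (θ ^ (1 - lam r)) k, ← Real.rpow_mul hθ0,
    mul_comm (1 - lam r) (k : ℝ), Real.rpow_mul hθ0, Real.rpow_natCast]
  ring

/-- **THE EXPONENT MADE ELEMENTARY**: `λ(r) ≤ (4∕π)·r` (`lam_le`), so for `0 < r < π∕4` the rate exponent is at least `1 − (4∕π)r` and the decay rate at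
least `(1 − (4∕π)r)·κ∕2`: with the data of `kingCov_twoSpacing_complexRate_uniform`, on `‖z‖ < (r∕(1+r))·min(r_K∕w₀, 1)`,
`‖C^{(k+1)}_{z·v} − C^{(k)}_{z·v}‖(x,y) ≤ (C·θ^k)^{1−(4∕π)r}·M^{(4∕π)r}·e^{−(1−(4∕π)r)(κ∕2)|x−y|_T}` (monotonicity of `t ↦ m^{1−t}M^{t}` for `m ≤ M`).
[cite: Ransford1995, Thm. 4.3.7; King1986, Lemma 4.5 (4.38) p.674 (A = 0 template)] -/
theorem kingCov_twoSpacing_complexRate_uniform_lin (hLodd : Odd L) (hL : 2 ≤ L) {a m2 : ℝ} (ha : 0 < a) (hm : 0 < m2) :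
    ∃ κ w₁ C : ℝ, 0 < κ ∧ 0 < w₁ ∧ 0 < C ∧
      ∀ (e : ℕ) (v : ∀ N : ℕ, Tor (fine N (kingU d L e)) → ℝ) (w₀ ν₀ s : ℝ),
      0 ≤ ν₀ → ν₀ ≤ w₁ → 0 ≤ s → s ≤ (L : ℝ) ^ (-(1 / 2 : ℝ)) →
      0 < w₀ → (∀ (N : ℕ) (x : Tor (fine N (kingU d L e))), |v N x| ≤ w₀) → w₀ ≤ w₁ →
      (∀ (k : ℕ), 1 ≤ k → ∀ x' : Tor (fine (L ^ 1 * L ^ k) (kingU d L e)),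
          |v (L ^ 1 * L ^ k) x' - v (L ^ k) (underPtN L k 1 (kingU d L e) x')| ≤ ν₀ * s ^ k) →
      ∀ (x y : Tor (kingU d L e)) (k : ℕ), 1 ≤ k →
      ∀ (r : ℝ), 0 < r → r < Real.pi / 4 → ∀ z : ℂ, ‖z‖ < r / (1 + r) * min (cplxWindow d a m2 L / w₀) 1 →
        ‖kingCovPotC d a m2 L (kingM d L e) (k + 1) z (v (L ^ (k + 1))) x y - kingCovPotC d a m2 L (kingM d L e) k z (v (L ^ k)) x y‖
          ≤ (C * (((L : ℝ) ^ (-(1 / 4 : ℝ))) ^ k)) ^ (1 - 4 / Real.pi * r) * (max C (4 / gam0L (d + 1) a L)) ^ (4 / Real.pi * r)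
              * Real.exp (-((1 - 4 / Real.pi * r) * (κ / 2) * tdistT (kingU d L e) x y)) := by
  obtain ⟨κ, w₁, C, hκ, hw₁, hC, H⟩ := kingCov_twoSpacing_complexRate_uniform (d := d) L hLodd hL ha hm
  refine ⟨κ, w₁, C, hκ, hw₁, hC, ?_⟩
  intro e v w₀ ν₀ s hν₀ hν₁ hs0 hs1 hw₀ hv hw₁' hcoh x y k hk r hr0 hr1 z hz
  have hpi := Real.pi_pos
  have hπ4 : Real.pi / 4 < 1 := by linarith [Real.pi_lt_four]
  have hr1' : r < 1 := hr1.trans hπ4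
  have h := H e v w₀ ν₀ s hν₀ hν₁ hs0 hs1 hw₀ hv hw₁' hcoh x y k hk r hr0 hr1' z hz
  refine h.trans ?_
  have hγ := gam0L_pos (d := d + 1) ha hL
  set θ : ℝ := (L : ℝ) ^ (-(1 / 4 : ℝ)) with hθ
  set m : ℝ := C * θ ^ k with hmdef
  set Mb : ℝ := max C (4 / gam0L (d + 1) a L) with hMb
  set l' : ℝ := 4 / Real.pi * r with hl'
  have hθ0 : 0 ≤ θ := Real.rpow_nonneg (Nat.cast_nonneg _) _
  have hθ1 : θ ≤ 1 := by
    have hL1 : (1 : ℝ) ≤ L := by exact_mod_cast (by omega : 1 ≤ L)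
    exact Real.rpow_le_one_of_one_le_of_nonpos hL1 (by norm_num)
  have hmpos : 0 < m := by positivity
  have hmM : m ≤ Mb := (mul_le_of_le_one_right hC.le (pow_le_one₀ hθ0 hθ1)).trans (le_max_left _ _)
  have hMpos : 0 < Mb := lt_of_lt_of_le hmpos hmM
  have hlamle : lam r ≤ l' := lam_le hr0.le hr1'
  have hl'1 : l' ≤ 1 := by
    rw [hl']
    have : 4 / Real.pi * r < 4 / Real.pi * (Real.pi / 4) := mul_lt_mul_of_pos_left hr1 (by positivity)
    have e4 : 4 / Real.pi * (Real.pi / 4) = 1 := by field_simp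
    linarith
  have hd0 := (tdistT_isPseudoDist (kingU d L e)).nonneg x y
  -- monotonicity of the interpolation in the exponent
  have hmono : m ^ (1 - lam r) * Mb ^ lam r ≤ m ^ (1 - l') * Mb ^ l' := by
    have key : ∀ t : ℝ, m ^ (1 - t) * Mb ^ t = m * (Mb / m) ^ t := fun t => by
      rw [Real.div_rpow hMpos.le hmpos.le, Real.rpow_sub hmpos, Real.rpow_one]
      field_simp
    rw [key, key]
    exact mul_le_mul_of_nonneg_left (Real.rpow_le_rpow_of_exponent_le ((one_le_div hmpos).2 hmM) hlamle) hmpos.le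
  have hexp : Real.exp (-((1 - lam r) * (κ / 2) * tdistT (kingU d L e) x y)) ≤ Real.exp (-((1 - l') * (κ / 2) * tdistT (kingU d L e) x y)) := by
    apply Real.exp_le_exp.mpr
    have : (1 - l') * (κ / 2) * tdistT (kingU d L e) x y ≤ (1 - lam r) * (κ / 2) * tdistT (kingU d L e) x y := by
      apply mul_le_mul_of_nonneg_right _ hd0
      apply mul_le_mul_of_nonneg_right _ (by positivity)
      linarith
    linarith
  exact mul_le_mul hmono hexp (Real.exp_pos _).le (by positivity)

end Rate

end Summit.QuantumFields.YangMills.BalabanUVNodes.N15.KingModel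

end
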